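/-
Origin: expansion seat `planner-pub-hodgecm-pv09-0`, handover 2026-08-18T03:35:39Z (`HOME/pub-hodgecm-pv09/lean/Pv09/RallisUnfold.lean`, md5 b7ad0ccc, 203 lines);
landed by the gen-5 packager in gate run 19 as `HodgeCM/PerL34/RallisUnfold.lean` (verbatim).
-/
/-
Copyright: pub-hodgecm speedrun cell, prover pv09.  WIP file (module root `Pv09`, landing target
`HodgeCM/PerL34/RallisUnfold.lean`).  Imports Mathlib only.

# N31e (PerL v5, proof of Lemma 4.2(b), tex ll. 588–608) — the UNFOLDING step, abstract form

PerL, ll. 590–602 (verbatim mathematics, our labelling):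
  E(ι(u,u'),s₀;f_Φ) = Σ_{δ' ∈ U(W_i)(L₀)} f_Φ(ι(u,δ'⁻¹u'),s₀)                       [orbit lemma, `Pv09.DoublingOrbit`]
  f_Φ(ι(u,δ'⁻¹u'),s₀) = χ_V(δ'⁻¹u')⟨ω(u)φ,ω(δ'⁻¹u')φ⟩ = χ_V(u')⟨ω(u)φ,ω(δ'⁻¹u')φ⟩     [(eq:basic) = N31c; χ_V(δ') = 1]
  ⟨θ_φ(χ'),θ_φ(χ')⟩ = c ∫∫_{[U(W_i)]²} χ'(u) conj χ'(u') χ_V(u')⁻¹ E(ι(u,u'),s₀) du du'   [kernel identity = N31d]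
                   = c ∫_{[U(W_i)]} ∫_{U(W_i)(𝔸)} χ'(u) conj χ'(uy⁻¹) ⟨ω(u)φ,ω(uy⁻¹)φ⟩ dy du  [unfolding; licensed by N31f]
                   = c vol([U(W_i)]) ∫_{U(W_i)(𝔸)} ⟨ω(y)φ,φ⟩ χ'(y) dy.                 [χ', ω unitary]

DICTIONARY (abstract ↦ PerL):  `A` ↦ U(W_i)(𝔸) with Haar measure `μ`;  `Γ : Subgroup A` ↦ U(W_i)(L₀)
(countable, acting on `A` by LEFT multiplication, `γ • x = γ * x`);  `𝓕` ↦ a fundamental domain, so that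
`∫_{[U(W_i)]} F du := ∫ x in 𝓕, F x ∂μ` for left-Γ-invariant `F` and `vol([U(W_i)]) = μ 𝓕`;
`ω : A → S → S` ↦ the Weil representation restricted to U(W_i)(𝔸) acting on `S = 𝒮(𝕏(𝔸))` (only
multiplicativity, unitality and unitarity are used);  `χ'`, `χV` ↦ the Hecke characters χ', χ_V (unitary,
multiplicative, trivial on the rational points Γ — "rational cancellation", l. 592);  `f u u'` ↦
f_Φ(ι(u,u'),s₀);  `E u u'` ↦ E(ι(u,u'),s₀;f_Φ);  `K u u'` ↦ ∫_{[G_U]} θ_φ(g,u) conj θ_φ(g,u') dg;  `c` ↦ c.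
INNER PRODUCTS: PerL's ⟨a,b⟩ is linear in `a`; Mathlib's `inner ℂ a b` is conjugate-linear in `a`, so
PerL ⟨a,b⟩ = `inner ℂ b a`.  Hence (eq:basic) reads `f h₁ h₂ = χV h₂ * inner ℂ (ω h₂ φ) (ω h₁ φ)` and the
Rallis integrand ⟨ω(y)φ,φ⟩χ'(y) reads `inner ℂ φ (ω y φ) * χ' y`.

LABELLED HYPOTHESES of the main theorem `rallis_inner_product_formula`:
  (N31c)  `hbasic` — the two-variable basic identity (eq:basic), tex l. 566;
  (N31d)  `hK` — the kernel identity ∫_{[G_U]} θθ̄ = c χ_V(u')⁻¹ E(ι(u,u')), tex ll. 580–581, and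
          `hE` — convergence of the Siegel Eisenstein series at ι(u,u') RE-INDEXED over δ' ∈ U(W_i)(L₀)
          by the orbit lemma (tex ll. 588–591; the re-indexing bijection is proved in `Pv09.DoublingOrbit`);
  (N31f)  `hint` — absolute integrability of y ↦ ⟨ω(y)φ,φ⟩ on U(W_i)(𝔸) ("licensed by the absolute
          convergence of the resulting U(W_i)(𝔸)-integral, which is established place by place", l. 594).
Everything else (rational cancellation, unfolding, the unitary substitutions, the orientation χ'(y) —
review point R3/R2-E1' — coming out of (eq:basic)) is PROVED here (kernel-checked, Mathlib only).
-/
import Mathlib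

/-! PORT of `HodgeCM/PerL34/RallisUnfold.lean` (HodgeCMPerL run 82) — verbatim mechanical port; provenance in the PORT header line. -/

open MeasureTheory Complex ComplexConjugate

namespace HodgeCM.PerL34.RallisIP

variable {A : Type*} [Group A] {Γ : Subgroup A}
  {S : Type*} [NormedAddCommGroup S] [InnerProductSpace ℂ S]

/-- What is used of `ω = ω_ψ|_{U(W_i)(𝔸)}`: a multiplicative, unital action by maps preserving the inner
product (PerL l. 602: "unitarity of ω|_{U(W_i)}"). -/
structure IsUnitaryAction (ω : A → S → S) : Prop where
  map_one : ∀ v, ω 1 v = v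
  map_mul : ∀ g h v, ω (g * h) v = ω g (ω h v)
  inner_map : ∀ g v w, inner ℂ (ω g v) (ω g w) = inner ℂ v w

/-- What is used of the Hecke characters `χ'`, `χ_V` restricted to `U(W_i)(𝔸) = 𝔸_L^1`: multiplicative,
unitary, and trivial on the rational points `Γ = U(W_i)(L₀) ⊂ L^×` (PerL l. 592: "χ_V(δ') = 1 for the
principal idele δ'"). -/
structure IsAutChar (Γ : Subgroup A) (χ : A → ℂ) : Prop where
  map_mul : ∀ g h, χ (g * h) = χ g * χ h
  norm_eq : ∀ g, ‖χ g‖ = 1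
  triv : ∀ γ : Γ, χ γ = 1

namespace IsAutChar

variable {χ : A → ℂ}

/-- (Ported verbatim from the HodgeCMPerL package; no docstring in the source.) -/
theorem ne_zero (hχ : IsAutChar Γ χ) (g : A) : χ g ≠ 0 := by
  intro h; have := hχ.norm_eq g; rw [h, norm_zero] at this; exact zero_ne_one this

/-- (Ported verbatim from the HodgeCMPerL package; no docstring in the source.) -/
theorem map_one (hχ : IsAutChar Γ χ) : χ 1 = 1 := by
  simpa using hχ.triv (1 : Γ)

/-- (Ported verbatim from the HodgeCMPerL package; no docstring in the source.) -/
theorem mul_conj (hχ : IsAutChar Γ χ) (g : A) : χ g * conj (χ g) = 1 := by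
  rw [Complex.mul_conj, Complex.normSq_eq_norm_sq, hχ.norm_eq g]; norm_num

/-- (Ported verbatim from the HodgeCMPerL package; no docstring in the source.) -/
theorem inv_eq_conj (hχ : IsAutChar Γ χ) (g : A) : (χ g)⁻¹ = conj (χ g) := by
  rw [Complex.inv_def, Complex.normSq_eq_norm_sq, hχ.norm_eq g]; norm_num

/-- (Ported verbatim from the HodgeCMPerL package; no docstring in the source.) -/
theorem map_inv (hχ : IsAutChar Γ χ) (g : A) : χ g⁻¹ = conj (χ g) := by
  have h := hχ.map_mul g g⁻¹
  rw [mul_inv_cancel, hχ.map_one] at h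
  rw [eq_inv_of_mul_eq_one_right h.symm, hχ.inv_eq_conj]

/-- rational cancellation: `χ(γ⁻¹ • x) = χ x` for `γ ∈ Γ`. -/
theorem smul_inv_left (hχ : IsAutChar Γ χ) (γ : Γ) (x : A) : χ (γ⁻¹ • x) = χ x := by
  show χ (((γ⁻¹ : Γ) : A) * x) = χ x
  rw [hχ.map_mul, hχ.triv, one_mul]

end IsAutChar

section unfolding

/-- The function that gets unfolded (PerL l. 594–595): `F u x = conj χ'(x) ⟨ω(u)φ, ω(x)φ⟩`. -/
noncomputable def unf (ω : A → S → S) (φ : S) (χ' : A → ℂ) (u x : A) : ℂ :=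
  conj (χ' x) * inner ℂ (ω x φ) (ω u φ)

variable {ω : A → S → S} {φ : S} {χ' χV : A → ℂ}

/-- (Ported verbatim from the HodgeCMPerL package; no docstring in the source.) -/
theorem inner_eq_coeff (hω : IsUnitaryAction ω) (u x : A) (φ : S) :
    inner ℂ (ω x φ) (ω u φ) = inner ℂ (ω (u⁻¹ * x) φ) φ := by
  have h := hω.inner_map u⁻¹ (ω x φ) (ω u φ)
  rw [← hω.map_mul, ← hω.map_mul, inv_mul_cancel, hω.map_one] at h
  exact h.symm

/-- pointwise re-indexed integrand (PerL ll. 590–593): by (eq:basic) and `χ_V(δ') = 1`,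
`conj χ'(u') χ_V(u')⁻¹ E(ι(u,u')) = Σ_{δ'} conj χ'(δ'⁻¹u') ⟨ω(u)φ, ω(δ'⁻¹u')φ⟩` — "no twist survives". -/
theorem integrand_eq_tsum (hχ' : IsAutChar Γ χ') (hχV : IsAutChar Γ χV)
    {f E : A → A → ℂ} (hbasic : ∀ h₁ h₂, f h₁ h₂ = χV h₂ * inner ℂ (ω h₂ φ) (ω h₁ φ))
    (hE : ∀ u u', HasSum (fun γ : Γ => f u (γ⁻¹ • u')) (E u u')) (u u' : A) :
    conj (χ' u') * (χV u')⁻¹ * E u u' = ∑' γ : Γ, unf ω φ χ' u (γ⁻¹ • u') := by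
  rw [← (hE u u').tsum_eq]
  have h1 : (fun γ : Γ => f u (γ⁻¹ • u')) = fun γ : Γ => χV u' * inner ℂ (ω (γ⁻¹ • u') φ) (ω u φ) := by
    funext γ; rw [hbasic, hχV.smul_inv_left]
  have h2 : (fun γ : Γ => unf ω φ χ' u (γ⁻¹ • u')) = fun γ : Γ => conj (χ' u') * inner ℂ (ω (γ⁻¹ • u') φ) (ω u φ) := by
    funext γ; rw [unf, hχ'.smul_inv_left]
  rw [h1, h2, tsum_mul_left, tsum_mul_left, ← mul_assoc, mul_assoc (conj (χ' u')),
    inv_mul_cancel₀ (hχV.ne_zero u'), mul_one]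

variable [MeasurableSpace A] [MeasurableMul₂ A] {μ : Measure A} [μ.IsMulLeftInvariant] {𝓕 : Set A}

/-- integrability of the unfolded function, from (N31f) integrability of the matrix coefficient. -/
theorem integrable_unf (hω : IsUnitaryAction ω) (hχ' : IsAutChar Γ χ') (hχ'm : Measurable χ')
    (hint : Integrable (fun y => inner ℂ φ (ω y φ)) μ) (u : A) : Integrable (unf ω φ χ' u) μ := by
  -- y ↦ ⟨φ, ω(y)φ⟩ (Mathlib `inner ℂ (ω y φ) φ`) is the conjugate of the (N31f) integrand
  have h0 : Integrable (fun y => inner ℂ (ω y φ) φ) μ := by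
    refine hint.norm.mono' (Complex.continuous_conj.comp_aestronglyMeasurable hint.1 |>.congr ?_) ?_
    · exact Filter.Eventually.of_forall fun y => by simp [inner_conj_symm]
    · exact Filter.Eventually.of_forall fun y => by rw [← inner_conj_symm, RCLike.norm_conj]
  have h1 : Integrable (fun x => inner ℂ (ω (u⁻¹ * x) φ) φ) μ := h0.comp_mul_left u⁻¹
  have h2 : Integrable (fun x => inner ℂ (ω x φ) (ω u φ)) μ :=
    h1.congr (Filter.Eventually.of_forall fun x => (inner_eq_coeff hω u x φ).symm)
  refine h2.bdd_mul (c := 1) (Complex.continuous_conj.measurable.comp hχ'm).aestronglyMeasurable ?_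
  exact Filter.Eventually.of_forall fun x => by rw [RCLike.norm_conj, hχ'.norm_eq]

/-- ABSTRACT UNFOLDING over a fundamental domain: `∫_𝓕 Σ_{γ∈Γ} F(γ⁻¹x) dx = ∫_A F` (Mathlib's
`IsFundamentalDomain.integral_eq_tsum'` plus dominated interchange of sum and integral). -/
theorem setIntegral_tsum_eq_integral [Countable Γ]
    (h𝓕 : IsFundamentalDomain Γ 𝓕 μ) {F : A → ℂ} (hF : Integrable F μ) :
    ∫ x in 𝓕, ∑' γ : Γ, F (γ⁻¹ • x) ∂μ = ∫ x, F x ∂μ := by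
  rw [h𝓕.integral_eq_tsum' F hF]
  refine integral_tsum (fun γ => ?_) ?_
  · exact ((hF.comp_mul_left ((γ⁻¹ : Γ) : A)).aestronglyMeasurable).restrict
  · rw [← h𝓕.lintegral_eq_tsum' (fun x => ‖F x‖ₑ)]
    exact hF.2.ne

/-- INNER INTEGRAL (PerL ll. 597–602, for fixed `u`): after unfolding and the substitution the
`u'`-integral no longer depends on `u`:
`∫_{[U(W_i)]} χ'(u) conj χ'(u') K(u,u') du' = c ∫_{U(W_i)(𝔸)} ⟨ω(y)φ,φ⟩ χ'(y) dy`. -/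
theorem inner_integral_eq [Countable Γ] [MeasurableInv A] [μ.IsInvInvariant]
    (h𝓕 : IsFundamentalDomain Γ 𝓕 μ) (hω : IsUnitaryAction ω)
    (hχ' : IsAutChar Γ χ') (hχ'm : Measurable χ') (hχV : IsAutChar Γ χV)
    {f E K : A → A → ℂ} {c : ℂ}
    (hbasic : ∀ h₁ h₂, f h₁ h₂ = χV h₂ * inner ℂ (ω h₂ φ) (ω h₁ φ))
    (hE : ∀ u u', HasSum (fun γ : Γ => f u (γ⁻¹ • u')) (E u u'))
    (hK : ∀ u u', K u u' = c * (χV u')⁻¹ * E u u')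
    (hint : Integrable (fun y => inner ℂ φ (ω y φ)) μ) (u : A) :
    ∫ u' in 𝓕, χ' u * conj (χ' u') * K u u' ∂μ = c * ∫ y, inner ℂ φ (ω y φ) * χ' y ∂μ := by
  -- step 1: rewrite the integrand through the kernel identity and the re-indexed Eisenstein sum
  have h1 : (fun u' => χ' u * conj (χ' u') * K u u')
      = fun u' => (χ' u * c) * ∑' γ : Γ, unf ω φ χ' u (γ⁻¹ • u') := by
    funext u'
    rw [hK, ← integrand_eq_tsum hχ' hχV hbasic hE u u']
    ring
  rw [h1, integral_const_mul, setIntegral_tsum_eq_integral h𝓕 (integrable_unf hω hχ' hχ'm hint u)]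
  -- step 2: substitute x = u y (left invariance), then y ↦ y⁻¹ (inversion invariance)
  have h2 : ∫ x, unf ω φ χ' u x ∂μ = ∫ y, unf ω φ χ' u (u * y) ∂μ :=
    (integral_mul_left_eq_self (unf ω φ χ' u) u).symm
  have h3 : (fun y => unf ω φ χ' u (u * y)) = fun y => conj (χ' u) * (conj (χ' y) * inner ℂ (ω y φ) φ) := by
    funext y
    simp only [unf]
    rw [hχ'.map_mul, map_mul, hω.map_mul, hω.inner_map, mul_assoc]
  have h4 : ∫ y, conj (χ' y) * inner ℂ (ω y φ) φ ∂μ = ∫ y, conj (χ' y⁻¹) * inner ℂ (ω y⁻¹ φ) φ ∂μ :=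
    (integral_inv_eq_self (fun y => conj (χ' y) * inner ℂ (ω y φ) φ) μ).symm
  have h5 : (fun y => conj (χ' y⁻¹) * inner ℂ (ω y⁻¹ φ) φ) = fun y => inner ℂ φ (ω y φ) * χ' y := by
    funext y
    have e : inner ℂ (ω y⁻¹ φ) φ = inner ℂ φ (ω y φ) := by
      have := hω.inner_map y (ω y⁻¹ φ) φ
      rw [← hω.map_mul, mul_inv_cancel, hω.map_one] at this
      exact this.symm
    rw [hχ'.map_inv, Complex.conj_conj, e, mul_comm]
  rw [h2, h3, integral_const_mul, h4, h5, ← mul_assoc, mul_assoc (χ' u), mul_comm c (conj (χ' u)),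
    ← mul_assoc, hχ'.mul_conj, one_mul]

/-- **N31e, abstract form — Rallis' inner product formula in Weil's convergent range, with PerL's
orientation** (tex ll. 597–600):
`⟨θ_φ(χ'),θ_φ(χ')⟩ = c ∫∫_{[U(W_i)]²} χ'(u) conj χ'(u') (∫_{[G_U]} θ_φ θ̄_φ) du' du
                  = c · vol([U(W_i)]) · ∫_{U(W_i)(𝔸)} ⟨ω(y)φ,φ⟩ χ'(y) dy`.
The left side is written as the iterated integral over a fundamental domain; `vol = (μ 𝓕).toReal`. -/
theorem rallis_inner_product_formula [Countable Γ] [MeasurableInv A] [μ.IsInvInvariant]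
    (h𝓕 : IsFundamentalDomain Γ 𝓕 μ) (hω : IsUnitaryAction ω)
    (hχ' : IsAutChar Γ χ') (hχ'm : Measurable χ') (hχV : IsAutChar Γ χV)
    {f E K : A → A → ℂ} {c : ℂ}
    (hbasic : ∀ h₁ h₂, f h₁ h₂ = χV h₂ * inner ℂ (ω h₂ φ) (ω h₁ φ))
    (hE : ∀ u u', HasSum (fun γ : Γ => f u (γ⁻¹ • u')) (E u u'))
    (hK : ∀ u u', K u u' = c * (χV u')⁻¹ * E u u')
    (hint : Integrable (fun y => inner ℂ φ (ω y φ)) μ) :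
    ∫ u in 𝓕, ∫ u' in 𝓕, χ' u * conj (χ' u') * K u u' ∂μ ∂μ
      = c * (μ 𝓕).toReal * ∫ y, inner ℂ φ (ω y φ) * χ' y ∂μ := by
  have h : (fun u => ∫ u' in 𝓕, χ' u * conj (χ' u') * K u u' ∂μ)
      = fun _ => c * ∫ y, inner ℂ φ (ω y φ) * χ' y ∂μ := by
    funext u; exact inner_integral_eq h𝓕 hω hχ' hχ'm hχV hbasic hE hK hint u
  rw [h, setIntegral_const, Complex.real_smul, Measure.real]
  ring

end unfolding

end HodgeCM.PerL34.RallisIP
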